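import Literature.Probability.LatticeModels.PlusMinusStateGibbs
import HarnessLib

/-!
# Monotone (FKG) limits of Ising states and the DLR equations in a region

Topic `Probability/LatticeModels`. Georgii–Higuchi 2000 construct several states as **stochastically
monotone limits** of finite-volume Gibbs distributions (§4, (2): "the semi-infinite limit
`μ^±_up = lim_{Δ↑π_up} μ^±_Δ` which exists by stochastic monotonicity"; proof of Lemma 4.2: "the
stochastically increasing limit `μ⁺_- = lim_n μ⁺_{n,-}` exists. Clearly `μ⁺_- ∈ 𝒢`"), and use that
such limits are Gibbs measures for the volumes eventually covered. This file provides the abstract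
tools, on top of the tree's weak-limit constructor
`exists_measure_tendsto_integral_of_dependsOn` (`PlusMinusStateGibbs.lean`):

* `exists_limit_of_tendsto_integral_plusIndicator` — if the expectations of the increasing
  indicators `n_B = ∏_{x∈B}(1+σ_x)/2` converge along a sequence of probability measures, all local
  expectations converge and a limit probability measure exists (every local observable is a finite
  linear combination of the `n_B`, Friedli–Velenik 2017, Lemma 3.19);
* `exists_limit_of_antitone`, `exists_limit_of_monotone` — in particular for FKG-decreasing /
  increasing sequences, with the limit dominated by / dominating every term on increasing local
  observables;
* `IsGibbsIn W γ μ` — the DLR equations for the finite volumes inside a region `W ⊆ V` ("Gibbs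
  measure on `π_up` with boundary condition in `π_upᶜ`", GH §4); `isGibbsIn_isingSpecification_of_tendsto`
  — they pass to limits of local expectations when they hold eventually along the sequence
  (Friedli–Velenik 2017, Thm. 6.26, as in `isGibbsMeasure_of_tendsto_isingExpect_fixed_box`);
  `isGibbsIn_isingMeasure_fixed` — a finite-volume Gibbs distribution in `Δ` is Gibbs in `Δ`;
* `measure_apply_eq_one_of_tendsto` — frozen spins pass to the limit.

## References

* H.-O. Georgii, Y. Higuchi, J. Math. Phys. 41 (2000), §4, eq. (2) and proof of Lemma 4.2
  [GeorgiiHiguchi2000].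
* S. Friedli, Y. Velenik, *Statistical Mechanics of Lattice Systems* (CUP 2017), Lemma 3.19,
  Thm. 6.5, Thm. 6.26 [FriedliVelenik2017].
-/

noncomputable section

open MeasureTheory Filter Topology Finset
open Literature.Probability.Percolation

namespace Literature.Probability.LatticeModels

variable {d : ℕ}

/-! ### Limits from the convergence of the increasing indicators -/

/-- `n_B ≤ 1`. [folklore] -/
theorem plusIndicator_le_one' {V : Type*} (B : Finset V) (σ : SpinConfig V) : plusIndicator B σ ≤ 1 := by
  rw [plusIndicator_eq]; split_ifs <;> norm_num

/-- `n_B` depends only on the spins in `B`. [folklore] -/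
theorem dependsOn_plusIndicator' {V : Type*} (B : Finset V) :
    DependsOn (plusIndicator (V := V) B) (↑B : Set V) := by
  intro σ τ hst
  rw [plusIndicator_eq, plusIndicator_eq]
  have : (∀ x ∈ B, σ x = 1) ↔ ∀ x ∈ B, τ x = 1 :=
    ⟨fun h x hx => by rw [← hst x hx]; exact h x hx, fun h x hx => by rw [hst x hx]; exact h x hx⟩
  simp only [this]

/-- Every local observable is a finite linear combination of increasing indicators `n_B`, `B ⊆ D`
(Friedli–Velenik 2017, Lemma 3.19). [cite: FriedliVelenik2017, Lemma 3.19] -/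
theorem exists_sum_plusIndicator_of_dependsOn (D : Finset (Site d)) {F : SpinConfig (Site d) → ℝ}
    (hF : DependsOn F (↑D : Set (Site d))) :
    ∃ c : Finset (Site d) → ℝ, ∀ σ, F σ = ∑ S ∈ D.powerset, c S * plusIndicator S σ := by
  classical
  obtain ⟨c, hc⟩ := exists_sum_spinProduct_of_dependsOn D hF
  set emb : ↥D ↪ Site d := Function.Embedding.subtype (· ∈ D) with hemb
  refine ⟨fun S => ∑ B : Finset ↥D,
    (if S ⊆ B.map emb then c B * ((-1 : ℝ) ^ #(B.map emb \ S) * 2 ^ #S) else 0), fun σ => ?_⟩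
  rw [hc σ]
  have hBD : ∀ B : Finset ↥D, B.map emb ⊆ D := fun B x hx => by
    obtain ⟨y, -, rfl⟩ := Finset.mem_map.1 hx
    exact y.2
  have h1 : ∀ B : Finset ↥D, c B * spinProduct (B.map emb) σ =
      ∑ S ∈ D.powerset, (if S ⊆ B.map emb then c B * ((-1 : ℝ) ^ #(B.map emb \ S) * 2 ^ #S) else 0) *
        plusIndicator S σ := by
    intro B
    rw [spinProduct_eq_sum_plusIndicator, Finset.mul_sum,
      ← Finset.sum_subset (Finset.powerset_mono.2 (hBD B))]
    · refine Finset.sum_congr rfl fun S hS => ?_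
      rw [Finset.mem_powerset] at hS
      simp only [hS, if_true]; ring
    · intro S _ hS
      rw [Finset.mem_powerset] at hS
      simp only [hS, if_false, zero_mul]
  rw [Finset.sum_congr rfl fun B _ => h1 B, Finset.sum_comm]
  refine Finset.sum_congr rfl fun S _ => ?_
  rw [Finset.sum_mul]

/-- **Limit states from the convergence of the increasing indicators**: if `ν_L` are probability
measures on `{±1}^{ℤ^d}` such that `∫ n_B dν_L` converges for every finite `B`, then there is a
probability measure `μ` with `∫ F dν_L → ∫ F dμ` for every local observable `F`
(Friedli–Velenik 2017, Thm. 6.5 with Lemma 3.19; the tree's Kolmogorov-extension constructor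
`exists_measure_tendsto_integral_of_dependsOn`). [cite: FriedliVelenik2017, Thm. 6.5] -/
theorem exists_limit_of_tendsto_integral_plusIndicator (ν : ℕ → Measure (SpinConfig (Site d)))
    [∀ L, IsProbabilityMeasure (ν L)]
    (hconv : ∀ B : Finset (Site d), ∃ a : ℝ,
      Tendsto (fun L => ∫ σ, plusIndicator B σ ∂(ν L)) atTop (𝓝 a)) :
    ∃ μ : Measure (SpinConfig (Site d)), IsProbabilityMeasure μ ∧
      ∀ (D : Finset (Site d)) (F : SpinConfig (Site d) → ℝ), DependsOn F (↑D : Set (Site d)) →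
        Tendsto (fun L => ∫ σ, F σ ∂(ν L)) atTop (𝓝 (∫ σ, F σ ∂μ)) := by
  classical
  refine exists_measure_tendsto_integral_of_dependsOn ν fun D F hF => ?_
  obtain ⟨c, hFc⟩ := exists_sum_plusIndicator_of_dependsOn D hF
  choose a ha using hconv
  refine ⟨∑ S ∈ D.powerset, c S * a S, ?_⟩
  have hint : ∀ (L : ℕ) (S : Finset (Site d)), Integrable (plusIndicator S) (ν L) := fun L S =>
    Integrable.of_bound (measurable_plusIndicator S).aestronglyMeasurable 1
      (Eventually.of_forall fun σ => by
        rw [Real.norm_eq_abs, abs_of_nonneg (plusIndicator_nonneg S σ)]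
        exact plusIndicator_le_one' S σ)
  have hL : ∀ L, ∫ σ, F σ ∂(ν L) = ∑ S ∈ D.powerset, c S * ∫ σ, plusIndicator S σ ∂(ν L) := by
    intro L
    rw [show (fun σ => F σ) = fun σ => ∑ S ∈ D.powerset, c S * plusIndicator S σ from funext hFc,
      integral_finsetSum _ fun S _ => (hint L S).const_mul _]
    exact Finset.sum_congr rfl fun S _ => integral_const_mul _ _
  simp_rw [hL]
  exact tendsto_finsetSum _ fun S _ => (ha S).const_mul _

/-- **Stochastically decreasing sequences have a limit** (Georgii–Higuchi 2000, §4 (2): "exists by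
stochastic monotonicity"): if `∫ f dν_{L+1} ≤ ∫ f dν_L` for every nondecreasing local bounded
measurable `f`, then a limit probability measure `μ` exists, `∫ F dν_L → ∫ F dμ` for all local `F`,
and `∫ f dμ ≤ ∫ f dν_L` for all such `f` and all `L`. [cite: GeorgiiHiguchi2000, §4 eq. (2)] -/
theorem exists_limit_of_antitone (ν : ℕ → Measure (SpinConfig (Site d))) [∀ L, IsProbabilityMeasure (ν L)]
    (hanti : ∀ (D : Finset (Site d)) (f : SpinConfig (Site d) → ℝ), DependsOn f (↑D : Set (Site d)) →
      Monotone f → Measurable f → (∀ σ, |f σ| ≤ 1) →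
        Antitone fun L => ∫ σ, f σ ∂(ν L)) :
    ∃ μ : Measure (SpinConfig (Site d)), IsProbabilityMeasure μ ∧
      (∀ (D : Finset (Site d)) (F : SpinConfig (Site d) → ℝ), DependsOn F (↑D : Set (Site d)) →
        Tendsto (fun L => ∫ σ, F σ ∂(ν L)) atTop (𝓝 (∫ σ, F σ ∂μ))) ∧
      ∀ (D : Finset (Site d)) (f : SpinConfig (Site d) → ℝ), DependsOn f (↑D : Set (Site d)) →
        Monotone f → Measurable f → (∀ σ, |f σ| ≤ 1) →
          ∀ L, ∫ σ, f σ ∂μ ≤ ∫ σ, f σ ∂(ν L) := by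
  have hconv : ∀ B : Finset (Site d), ∃ a : ℝ,
      Tendsto (fun L => ∫ σ, plusIndicator B σ ∂(ν L)) atTop (𝓝 a) := by
    intro B
    have ha : Antitone fun L => ∫ σ, plusIndicator B σ ∂(ν L) :=
      hanti B _ (dependsOn_plusIndicator' B) (plusIndicator_mono B) (measurable_plusIndicator B)
        fun σ => by rw [abs_of_nonneg (plusIndicator_nonneg B σ)]; exact plusIndicator_le_one' B σ
    refine ⟨⨅ L, ∫ σ, plusIndicator B σ ∂(ν L), tendsto_atTop_ciInf ha ⟨0, ?_⟩⟩
    rintro _ ⟨L, rfl⟩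
    exact integral_nonneg fun σ => plusIndicator_nonneg B σ
  obtain ⟨μ, hμP, hμ⟩ := exists_limit_of_tendsto_integral_plusIndicator ν hconv
  refine ⟨μ, hμP, hμ, fun D f hfD hf hfm hfb L => ?_⟩
  have ha := hanti D f hfD hf hfm hfb
  exact le_of_tendsto (hμ D f hfD) (eventually_atTop.2 ⟨L, fun L' hL' => ha hL'⟩)

/-- **Stochastically increasing sequences have a limit** (Georgii–Higuchi 2000, proof of Lemma 4.2:
"the stochastically increasing limit `μ⁺_- = lim_n μ⁺_{n,-}` exists"): dual statement, with
`∫ f dν_L ≤ ∫ f dμ`. [cite: GeorgiiHiguchi2000, Lemma 4.2 (proof)] -/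
theorem exists_limit_of_monotone (ν : ℕ → Measure (SpinConfig (Site d))) [∀ L, IsProbabilityMeasure (ν L)]
    (hmono : ∀ (D : Finset (Site d)) (f : SpinConfig (Site d) → ℝ), DependsOn f (↑D : Set (Site d)) →
      Monotone f → Measurable f → (∀ σ, |f σ| ≤ 1) →
        Monotone fun L => ∫ σ, f σ ∂(ν L)) :
    ∃ μ : Measure (SpinConfig (Site d)), IsProbabilityMeasure μ ∧
      (∀ (D : Finset (Site d)) (F : SpinConfig (Site d) → ℝ), DependsOn F (↑D : Set (Site d)) →
        Tendsto (fun L => ∫ σ, F σ ∂(ν L)) atTop (𝓝 (∫ σ, F σ ∂μ))) ∧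
      ∀ (D : Finset (Site d)) (f : SpinConfig (Site d) → ℝ), DependsOn f (↑D : Set (Site d)) →
        Monotone f → Measurable f → (∀ σ, |f σ| ≤ 1) →
          ∀ L, ∫ σ, f σ ∂(ν L) ≤ ∫ σ, f σ ∂μ := by
  have hconv : ∀ B : Finset (Site d), ∃ a : ℝ,
      Tendsto (fun L => ∫ σ, plusIndicator B σ ∂(ν L)) atTop (𝓝 a) := by
    intro B
    have hm : Monotone fun L => ∫ σ, plusIndicator B σ ∂(ν L) :=
      hmono B _ (dependsOn_plusIndicator' B) (plusIndicator_mono B) (measurable_plusIndicator B)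
        fun σ => by rw [abs_of_nonneg (plusIndicator_nonneg B σ)]; exact plusIndicator_le_one' B σ
    refine ⟨⨆ L, ∫ σ, plusIndicator B σ ∂(ν L), tendsto_atTop_ciSup hm ⟨1, ?_⟩⟩
    rintro _ ⟨L, rfl⟩
    calc ∫ σ, plusIndicator B σ ∂(ν L) ≤ ∫ _σ, (1 : ℝ) ∂(ν L) :=
          integral_mono_of_nonneg (Eventually.of_forall fun σ => plusIndicator_nonneg B σ)
            (integrable_const _) (Eventually.of_forall fun σ => plusIndicator_le_one' B σ)
      _ = 1 := by simp
  obtain ⟨μ, hμP, hμ⟩ := exists_limit_of_tendsto_integral_plusIndicator ν hconv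
  refine ⟨μ, hμP, hμ, fun D f hfD hf hfm hfb L => ?_⟩
  have hm := hmono D f hfD hf hfm hfb
  exact ge_of_tendsto (hμ D f hfD) (eventually_atTop.2 ⟨L, fun L' hL' => hm hL'⟩)

/-! ### The DLR equations in a region -/

section Region

variable {V S : Type*} [MeasurableSpace S]

/-- `μ` is a **Gibbs measure in the region `W`** for the specification `γ`: a probability measure
satisfying the DLR equations `∫ γ_Λ(A | η) μ(dη) = μ(A)` for every finite `Λ ⊆ W` (Georgii–Higuchi
2000, §4: "Gibbs measures on `π_up` with `-`boundary condition in `π_upᶜ`"; with `W = univ` this is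
`IsGibbsMeasure`). [cite: GeorgiiHiguchi2000, §4 (proof of Lemma 4.2)] -/
def IsGibbsIn (W : Set V) (γ : Specification V S) (μ : Measure (V → S)) : Prop :=
  IsProbabilityMeasure μ ∧
    ∀ Λ : Finset V, (↑Λ : Set V) ⊆ W → ∀ A : Set (V → S), MeasurableSet A → ∫⁻ η, γ Λ η A ∂μ = μ A

/-- Gibbs in the whole space is Gibbs. [folklore] -/
theorem isGibbsIn_univ_iff {γ : Specification V S} {μ : Measure (V → S)} :
    IsGibbsIn Set.univ γ μ ↔ IsGibbsMeasure γ μ :=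
  ⟨fun h => ⟨h.1, fun Λ A hA => h.2 Λ (Set.subset_univ _) A hA⟩,
    fun h => ⟨h.1, fun Λ _ A hA => h.2 Λ A hA⟩⟩

/-- Gibbs in a region is Gibbs in every subregion. [folklore] -/
theorem IsGibbsIn.mono {W W' : Set V} (h : W' ⊆ W) {γ : Specification V S} {μ : Measure (V → S)}
    (hμ : IsGibbsIn W γ μ) : IsGibbsIn W' γ μ :=
  ⟨hμ.1, fun Λ hΛ A hA => hμ.2 Λ (hΛ.trans h) A hA⟩

end Region

/-- **A finite-volume Gibbs distribution is Gibbs in its volume**: `μ^η_Δ` satisfies the DLR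
equations for every `Λ ⊆ Δ` (consistency of the Ising kernels, Friedli–Velenik 2017, Lemma 6.7;
the tree's `lintegral_isingMeasure_fixed_consistent`). [cite: FriedliVelenik2017, Lemma 6.7] -/
theorem isGibbsIn_isingMeasure_fixed {V : Type*} (G : SimpleGraph V) [DecidableEq V] [G.LocallyFinite]
    (Δ : Finset V) (β h : ℝ) (η : SpinConfig V) :
    IsGibbsIn (↑Δ : Set V) (isingSpecification G β h) (isingMeasure G Δ β h (.fixed η)) := by
  refine ⟨inferInstance, fun Λ hΛ A hA => ?_⟩
  simp only [isingSpecification_apply]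
  exact lintegral_isingMeasure_fixed_consistent G (Finset.coe_subset.1 hΛ) β h η hA

/-- **The DLR equations in a region pass to limits** (Friedli–Velenik 2017, Thm. 6.26, for the Ising
specification of `ℤ^d`): if the local expectations under the probability measures `ν_L` converge to
those under `μ`, and for every finite `Λ ⊆ W` the DLR equation for `Λ` holds for `ν_L` eventually,
then `μ` is Gibbs in `W`. Proof as for `isGibbsMeasure_of_tendsto_isingExpect_fixed_box`: for a local
event `A`, `η ↦ μ^η_Λ(A)` is a local observable, so both sides of the DLR equation are limits. [cite: FriedliVelenik2017, Thm. 6.26] -/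
theorem isGibbsIn_isingSpecification_of_tendsto {β h : ℝ} (W : Set (Site d))
    (ν : ℕ → Measure (SpinConfig (Site d))) [∀ L, IsProbabilityMeasure (ν L)]
    (μ : Measure (SpinConfig (Site d))) [IsProbabilityMeasure μ]
    (hμ : ∀ (D : Finset (Site d)) (F : SpinConfig (Site d) → ℝ), DependsOn F (↑D : Set (Site d)) →
      Tendsto (fun L => ∫ σ, F σ ∂(ν L)) atTop (𝓝 (∫ σ, F σ ∂μ)))
    (hDLR : ∀ Λ : Finset (Site d), (↑Λ : Set (Site d)) ⊆ W → ∀ A : Set (SpinConfig (Site d)),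
      MeasurableSet A → ∀ᶠ L in atTop,
        ∫⁻ η, isingSpecification (zdGraph d) β h Λ η A ∂(ν L) = (ν L) A) :
    IsGibbsIn W (isingSpecification (zdGraph d) β h) μ := by
  classical
  refine ⟨inferInstance, fun Λ hΛ A hA => ?_⟩
  set e := spinConfigEquivSet (Site d) with he
  set κ : SpinConfig (Site d) → Measure (SpinConfig (Site d)) :=
    fun ζ => isingMeasure (zdGraph d) Λ β h (.fixed ζ) with hκ
  have hκm : Measurable κ := measurable_isingMeasure_fixed_zd Λ β h
  haveI : ∀ ζ, IsProbabilityMeasure (κ ζ) := fun ζ => by rw [hκ]; infer_instance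
  set ν₁ : Measure (SpinConfig (Site d)) := μ.bind κ with hν₁
  have hν₁_apply : ∀ {T : Set (SpinConfig (Site d))}, MeasurableSet T →
      ν₁ T = ∫⁻ ζ, κ ζ T ∂μ := fun hT => Measure.bind_apply hT hκm.aemeasurable
  haveI : IsProbabilityMeasure ν₁ := ⟨by
    rw [hν₁_apply MeasurableSet.univ]
    simp⟩
  suffices hmain : ν₁ = μ by
    have := hν₁_apply hA
    rw [hmain] at this
    simpa [hκ] using this.symm
  refine measure_eq_of_forall_isLocalEvent_preimage_eq ν₁ μ fun A' hA' => ?_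
  obtain ⟨J, hJ⟩ := hA'
  have hA'm : MeasurableSet A' := measurableSet_of_isLocalEvent_holds ⟨J, hJ⟩
  set T : Set (SpinConfig (Site d)) := e ⁻¹' A' with hT
  have hTm : MeasurableSet T := e.measurable hA'm
  have hTdep : ∀ σ τ : SpinConfig (Site d), (∀ x ∈ J, σ x = τ x) → (σ ∈ T ↔ τ ∈ T) := by
    intro σ τ hst
    exact (determinedBy_iff A' _).1 hJ _ _ (spinConfigEquivSet_inter_eq fun x hx => hst x hx)
  -- the boundary-condition dependence `g ζ = μ^ζ_Λ(T)` is a local observable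
  set g : SpinConfig (Site d) → ℝ := fun ζ => (κ ζ).real T with hg
  have hgdep : DependsOn g (↑(outerBoundary (zdGraph d) Λ ∪ J) : Set (Site d)) :=
    dependsOn_isingMeasure_fixed_real Λ J β h hTm hTdep
  have hgm : Measurable g := DependsOn.measurable_of_finset _ hgdep
  have hg0 : ∀ ζ, 0 ≤ g ζ := fun ζ => measureReal_nonneg
  have hg1 : ∀ ζ, g ζ ≤ 1 := fun ζ => measureReal_le_one
  have hgi : ∀ (ρ : Measure (SpinConfig (Site d))) [IsFiniteMeasure ρ], Integrable g ρ := fun ρ _ =>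
    Integrable.of_bound hgm.aestronglyMeasurable 1 (Eventually.of_forall fun ζ => by
      rw [Real.norm_eq_abs, abs_of_nonneg (hg0 ζ)]; exact hg1 ζ)
  have hκT : ∀ ζ, κ ζ T = ENNReal.ofReal (g ζ) := fun ζ => (ofReal_measureReal).symm
  have h1 : ν₁ T = ENNReal.ofReal (∫ ζ, g ζ ∂μ) := by
    rw [hν₁_apply hTm]
    simp_rw [hκT]
    exact (ofReal_integral_eq_lintegral_ofReal (hgi μ) (Eventually.of_forall hg0)).symm
  set χ : SpinConfig (Site d) → ℝ := T.indicator 1 with hχ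
  have hχdep : DependsOn χ (↑J : Set (Site d)) := dependsOn_indicator_preimage_of_determinedBy hJ
  -- along the sequence, `∫ g dν_L = ν_L(T) = ∫ χ dν_L` eventually (DLR for `ν_L`)
  have hev : ∀ᶠ L in atTop, ∫ ζ, g ζ ∂(ν L) = ∫ σ, χ σ ∂(ν L) := by
    filter_upwards [hDLR Λ hΛ T hTm] with L hL
    have hl : ∫⁻ σ, isingSpecification (zdGraph d) β h Λ σ T ∂(ν L) = ENNReal.ofReal (∫ ζ, g ζ ∂(ν L)) := by
      change ∫⁻ σ, κ σ T ∂_ = _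
      simp_rw [hκT]
      exact (ofReal_integral_eq_lintegral_ofReal (hgi _) (Eventually.of_forall hg0)).symm
    have hr : (ν L) T = ENNReal.ofReal (∫ σ, χ σ ∂(ν L)) := by
      rw [hχ, integral_indicator_one hTm, ofReal_measureReal]
    rw [hl, hr] at hL
    have hgE : 0 ≤ ∫ ζ, g ζ ∂(ν L) := integral_nonneg hg0
    have hχE : 0 ≤ ∫ σ, χ σ ∂(ν L) :=
      integral_nonneg fun σ => Set.indicator_nonneg (fun _ _ => zero_le_one) σ
    exact (ENNReal.ofReal_eq_ofReal_iff hgE hχE).1 hL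
  have hlimg := hμ _ g hgdep
  have hlimχ := hμ J χ hχdep
  have heq : ∫ ζ, g ζ ∂μ = ∫ σ, χ σ ∂μ :=
    tendsto_nhds_unique hlimg (hlimχ.congr' (hev.mono fun L hL => hL.symm))
  rw [h1, heq, hχ, integral_indicator_one hTm, ofReal_measureReal]

/-- **Limits of Gibbs-in-`W_L` measures are Gibbs in `⋃ W_L`** (monotone regions): the form used
for `μ⁺_- = lim μ⁺_{n,-} ∈ 𝒢` (Georgii–Higuchi 2000, proof of Lemma 4.2). [cite: GeorgiiHiguchi2000, Lemma 4.2 (proof)] -/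
theorem isGibbsIn_iUnion_of_tendsto {β h : ℝ} (W : ℕ → Set (Site d)) (hW : Monotone W)
    (ν : ℕ → Measure (SpinConfig (Site d))) [∀ L, IsProbabilityMeasure (ν L)]
    (hν : ∀ L, IsGibbsIn (W L) (isingSpecification (zdGraph d) β h) (ν L))
    (μ : Measure (SpinConfig (Site d))) [IsProbabilityMeasure μ]
    (hμ : ∀ (D : Finset (Site d)) (F : SpinConfig (Site d) → ℝ), DependsOn F (↑D : Set (Site d)) →
      Tendsto (fun L => ∫ σ, F σ ∂(ν L)) atTop (𝓝 (∫ σ, F σ ∂μ))) :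
    IsGibbsIn (⋃ L, W L) (isingSpecification (zdGraph d) β h) μ := by
  refine isGibbsIn_isingSpecification_of_tendsto _ ν μ hμ fun Λ hΛ A hA => ?_
  -- the finite set `Λ` lies in some `W L₀`
  obtain ⟨L₀, hL₀⟩ : ∃ L₀, (↑Λ : Set (Site d)) ⊆ W L₀ := by
    have h' : ∀ x ∈ Λ, ∃ L, x ∈ W L := fun x hx => Set.mem_iUnion.1 (hΛ (Finset.mem_coe.2 hx))
    choose! L hL using h'
    refine ⟨Λ.sup L, fun x hx => hW (Finset.le_sup (Finset.mem_coe.1 hx)) (hL x (Finset.mem_coe.1 hx))⟩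
  filter_upwards [eventually_ge_atTop L₀] with L hL
  exact (hν L).2 Λ (hL₀.trans (hW hL)) A hA

/-! ### Frozen spins pass to the limit -/

/-- If `ν_L{σ_x = s} = 1` eventually, then `μ{σ_x = s} = 1` for the limit of local expectations. [folklore] -/
theorem measure_apply_eq_one_of_tendsto (ν : ℕ → Measure (SpinConfig (Site d))) [∀ L, IsProbabilityMeasure (ν L)]
    (μ : Measure (SpinConfig (Site d))) [IsProbabilityMeasure μ]
    (hμ : ∀ (D : Finset (Site d)) (F : SpinConfig (Site d) → ℝ), DependsOn F (↑D : Set (Site d)) →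
      Tendsto (fun L => ∫ σ, F σ ∂(ν L)) atTop (𝓝 (∫ σ, F σ ∂μ)))
    (x : Site d) (s : ℤˣ) (hfrozen : ∀ᶠ L in atTop, (ν L) {σ | σ x = s} = 1) :
    μ {σ : SpinConfig (Site d) | σ x = s} = 1 := by
  have hm : MeasurableSet {σ : SpinConfig (Site d) | σ x = s} :=
    measurableSet_eq_fun (measurable_pi_apply x) measurable_const
  set χ : SpinConfig (Site d) → ℝ := {σ : SpinConfig (Site d) | σ x = s}.indicator 1 with hχ
  have hχdep : DependsOn χ (↑({x} : Finset (Site d)) : Set (Site d)) := by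
    intro σ τ hst
    have hx : σ x = τ x := hst x (by simp)
    simp only [hχ, Set.indicator_apply, Set.mem_setOf_eq, hx, Pi.one_apply]
  have hlim := hμ {x} χ hχdep
  have hev : ∀ᶠ L in atTop, ∫ σ, χ σ ∂(ν L) = 1 := by
    filter_upwards [hfrozen] with L hL
    rw [hχ, integral_indicator_one hm, measureReal_def, hL, ENNReal.toReal_one]
  have h1 : ∫ σ, χ σ ∂μ = 1 := tendsto_nhds_unique hlim (tendsto_const_nhds.congr' (hev.mono fun L hL => hL.symm))
  rw [hχ, integral_indicator_one hm, measureReal_def] at h1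
  exact (ENNReal.toReal_eq_one_iff _).1 h1

end Literature.Probability.LatticeModels
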